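import Summits.Ventures.Crystal3D.Theorems.StickyWulffConstantCoaxialWallLawTailResidueDefs2
import Summits.Ventures.Crystal3D.Theorems.StickyWulffConstantCoaxialWallLawRowsOfJoint
import Summits.Ventures.Crystal3D.Theorems.StickyWulffConstantCoaxialWallLawDustDeletionResidue
import HarnessLib

/-!
# Lane F's crux BY NAME from E1, the two 𝒰_cx certificates, `TailResidueCert₂ (2√6)` and `TailTypeSoundness₂`
# (crux `CoaxialWallLaw`, stmt-Ventures-19481, line `WallLedgerF`; cf-p1 Defs2 ruling 2026-08-29T02:58:12Z)

HONEST FRAMING. Venture `Summits/Ventures/Crystal3D` (cell `crystal3d-full`), helper `--supports` the crux `CoaxialWallLaw`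
(stmt-Ventures-19481, `route-Ventures-StickyWulffConstant`), REGISTERED line `WallLedgerF` (planner cf-p1).  Rung credit; F-C1 not
moved; CONDITIONAL on named facts (grade computational through the certified kissing facts of the capstone).  Supersedes
`…TailResidueClosing` (signature rows, loose-only special case) per the Defs2 ruling:

* `endRowJointTailA_of_cert₂` — flat(`s`) + jointFlat(`s`) + `TailResidueCert₂ s` + `TailTypeSoundness₂` ⇒ the joint tail at `s`;
* **`coaxialWallLaw_of_certificates₂ : P5Exhaustion → EndRowOnSiteFlatA v2 (9/2) 𝒰_cx → EndRowOnSiteJointFlatA v2 (2√6) 𝒰_cx →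
  TailResidueCert₂ (2√6) → TailTypeSoundness₂ → CoaxialWallLaw`** — THE CRUX from E1, bnb-ucx, 'jointrow', the T3 certificate and
  the ONE T4 lemma (via `coaxialWallLaw_of_jointTail_cx`, `…RowsOfJoint`: the joint row dominates both lane-F rows);
* `endRowJointA_of_certificates₂` — T-F2's `EndRowJointA v2 (2√6)` from the same inputs minus E1;
* `coaxialWallLaw_of_jointA_explicit`, **`coaxialWallLaw_of_certificates₂_explicit`** — the same with `KissingGap (5/2)`,
  `KissingClassification (5/2)`, `StarPairFar` BY NAME (census-free cone, for cf-p1's registrable skeleton (xcv)(2));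
* `localSummandFlatDec_le_of_systems`, `ResidueType.rowTrans_le_rowJoint`, `ResidueType.rowTwin_le_rowJoint` — the joint row of a
  type dominates its translation and twin rows (so one table serves all).
WHAT THIS IS NOT: no certificate, no soundness proof; F-C1 not moved.
-/

noncomputable section

namespace Summit.Ventures.Crystal3D.Theorems

open Summit.Ventures.Crystal3D Finset TailResidue
open scoped InnerProductSpace

/-- **The joint tail from the certificates (II) and type soundness (II)** (line `s`). -/
theorem endRowJointTailA_of_cert₂ {s : ℝ} (honT : EndRowOnSiteFlatA WordVersion.v2 s coaxialModuleUniverse)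
    (honJ : EndRowOnSiteJointFlatA WordVersion.v2 s coaxialModuleUniverse) (hcert : TailResidueCert₂ s)
    (hsound : TailTypeSoundness₂) : EndRowJointTailA WordVersion.v2 s coaxialModuleUniverse :=
  endRowJointTailA_of_residue honT honJ fun L X hX z hz hdeg hoff => by
    rcases hsound L X hX z hz hdeg hoff with h | ⟨τ, hwf, hre, L₀, hL₀, hle⟩
    · exact Or.inl h
    · exact Or.inr (hle.trans (hcert τ hwf hre L₀ hL₀))

/-- **T-F2's joint row by name (II)**: bnb-ucx at `9/2`, 'jointrow' at `2√6`, `TailResidueCert₂ (2√6)`, `TailTypeSoundness₂`. -/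
theorem endRowJointA_of_certificates₂ (honT : EndRowOnSiteFlatA WordVersion.v2 (9 / 2) coaxialModuleUniverse)
    (honJ : EndRowOnSiteJointFlatA WordVersion.v2 (2 * Real.sqrt 6) coaxialModuleUniverse)
    (hcert : TailResidueCert₂ (2 * Real.sqrt 6)) (hsound : TailTypeSoundness₂) : EndRowJointA WordVersion.v2 (2 * Real.sqrt 6) :=
  endRowJointA_v2_twoSqrtSix_cx honT honJ
    (endRowJointTailA_of_cert₂ (endRowOnSiteFlatA_mono_const nine_halves_le_two_sqrt_six honT) honJ hcert hsound)

/-- **LANE F'S CRUX BY NAME (II): `P5Exhaustion → EndRowOnSiteFlatA v2 (9/2) 𝒰_cx → EndRowOnSiteJointFlatA v2 (2√6) 𝒰_cx →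
TailResidueCert₂ (2√6) → TailTypeSoundness₂ → CoaxialWallLaw`.** -/
theorem coaxialWallLaw_of_certificates₂ (hE1 : P5Exhaustion)
    (honT : EndRowOnSiteFlatA WordVersion.v2 (9 / 2) coaxialModuleUniverse)
    (honJ : EndRowOnSiteJointFlatA WordVersion.v2 (2 * Real.sqrt 6) coaxialModuleUniverse)
    (hcert : TailResidueCert₂ (2 * Real.sqrt 6)) (hsound : TailTypeSoundness₂) :
    Summit.Ventures.Crystal3D.Theses.StickyWulffConstant.CoaxialWallLaw :=
  coaxialWallLaw_of_jointA_v2_twoSqrtSix hE1 (endRowJointA_of_certificates₂ honT honJ hcert hsound)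

/-! ### Census-free explicit forms (kissing facts and `StarPairFar` BY NAME, for the registrable skeleton) -/

/-- **The crux from the JOINT row, kissing facts and `StarPairFar` by name** (census-free cone; `δ` any gap constant). -/
theorem coaxialWallLaw_of_jointA_explicit (ver : WordVersion) {δ : ℝ} (hg : KissingGap δ) (hc : KissingClassification δ)
    {sF : ℝ} (hsF : 0 < sF) (hsF' : sF ≤ 2 * Real.sqrt 6) (hJ : EndRowJointA ver sF) (hE1 : P5Exhaustion) (hSP : StarPairFar) :
    Summit.Ventures.Crystal3D.Theses.StickyWulffConstant.CoaxialWallLaw :=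
  coaxialWallLaw_of_twoRowsA_p5 ver hg hc hsF hsF' (endRowTwinHalfTurnA_of_jointA hJ) (endRowTransA_of_jointA hJ) hE1 hSP

/-- **LANE F'S CRUX BY NAME, CENSUS-FREE CONE (for cf-p1's registrable skeleton):
`KissingGap (5/2) → KissingClassification (5/2) → StarPairFar → P5Exhaustion → EndRowOnSiteFlatA v2 (9/2) 𝒰_cx →
EndRowOnSiteJointFlatA v2 (2√6) 𝒰_cx → TailResidueCert₂ (2√6) → TailTypeSoundness₂ → CoaxialWallLaw`.** -/
theorem coaxialWallLaw_of_certificates₂_explicit (hg : KissingGap (5 / 2)) (hc : KissingClassification (5 / 2)) (hSP : StarPairFar)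
    (hE1 : P5Exhaustion) (honT : EndRowOnSiteFlatA WordVersion.v2 (9 / 2) coaxialModuleUniverse)
    (honJ : EndRowOnSiteJointFlatA WordVersion.v2 (2 * Real.sqrt 6) coaxialModuleUniverse)
    (hcert : TailResidueCert₂ (2 * Real.sqrt 6)) (hsound : TailTypeSoundness₂) :
    Summit.Ventures.Crystal3D.Theses.StickyWulffConstant.CoaxialWallLaw :=
  coaxialWallLaw_of_jointA_explicit WordVersion.v2 hg hc two_sqrt_six_pos le_rfl
    (endRowJointA_of_certificates₂ honT honJ hcert hsound) hE1 hSP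

/-! ### The joint row dominates the translation and twin rows of a type -/

section RowMono

variable {X : Finset (EuclideanSpace ℝ (Fin 3))} {v : WordVersion} {S₁ S₂ S₁' S₂' : PlateSystem}
  (hS : ∀ G d, S₁.Adm G d ∨ S₂.Adm G d → S₁'.Adm G d ∨ S₂'.Adm G d)
include hS

open scoped Classical in
/-- Flat multiplicities are monotone under inclusion of the admissible classes. -/
theorem endMultFlat_le_of_systems (b : EuclideanSpace ℝ (Fin 3)) : endMultFlat X v S₁ S₂ b ≤ endMultFlat X v S₁' S₂' b := by
  unfold endMultFlat
  refine card_le_card fun q hq => mem_filter.2 ⟨(mem_filter.1 hq).1, ?_⟩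
  obtain ⟨hq', hb, G, d, hadm, hpred, hmove⟩ := (mem_filter.1 hq).2
  exact ⟨hq', hb, G, d, hS G d hadm, hpred, hmove⟩

open scoped Classical in
/-- The kernel-literal decorated summand is monotone under inclusion of the admissible classes (pools with `κ ≥ 0`). -/
theorem localSummandFlatDec_le_of_systems {δ : EuclideanSpace ℝ (Fin 3) → ℕ} {κ : EuclideanSpace ℝ (Fin 3) → ℝ}
    (hκ : ∀ b, 0 ≤ κ b) (z : EuclideanSpace ℝ (Fin 3)) :
    localSummandFlatDec v S₁ S₂ X δ κ z ≤ localSummandFlatDec v S₁' S₂' X δ κ z := by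
  unfold localSummandFlatDec
  have hp : ∀ b, 0 ≤ pooledDefFlatDec X δ κ b := by
    intro b
    unfold pooledDefFlatDec
    refine add_nonneg (add_nonneg (sum_nonneg fun y hy => ?_) (hκ b)) (by split_ifs <;> norm_num)
    have : (degDec X δ y : ℝ) ≤ 11 := by exact_mod_cast (mem_filter.1 hy).2.2
    linarith
  calc ∑ b ∈ X.filter (fun b => dist z b ≤ 1 ∧ 0 < endMultFlat X v S₁ S₂ b), (endMultFlat X v S₁ S₂ b : ℝ) / pooledDefFlatDec X δ κ b
      ≤ ∑ b ∈ X.filter (fun b => dist z b ≤ 1 ∧ 0 < endMultFlat X v S₁ S₂ b),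
          (endMultFlat X v S₁' S₂' b : ℝ) / pooledDefFlatDec X δ κ b :=
        sum_le_sum fun b _ => div_le_div_of_nonneg_right (by exact_mod_cast endMultFlat_le_of_systems hS b) (hp b)
    _ ≤ ∑ b ∈ X.filter (fun b => dist z b ≤ 1 ∧ 0 < endMultFlat X v S₁' S₂' b),
          (endMultFlat X v S₁' S₂' b : ℝ) / pooledDefFlatDec X δ κ b := by
        refine sum_le_sum_of_subset_of_nonneg (fun b hb => ?_) fun b _ _ => div_nonneg (Nat.cast_nonneg _) (hp b)
        obtain ⟨hbX, hd, hpos⟩ := mem_filter.1 hb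
        exact mem_filter.2 ⟨hbX, hd, lt_of_lt_of_le hpos (endMultFlat_le_of_systems hS b)⟩

end RowMono

namespace TailResidue

/-- The filler credit is non-negative (`10 − #H ≥ 7` per loose filler touching `b`). -/
theorem ResidueType.fillerCredit_nonneg (τ : ResidueType) (hwf : τ.WellFormed₂) (b : EuclideanSpace ℝ (Fin 3)) :
    0 ≤ τ.fillerCredit b := by
  unfold ResidueType.fillerCredit
  refine List.sum_nonneg fun x hx => ?_
  obtain ⟨f, hf, rfl⟩ := List.mem_map.1 hx
  have hwf_f := hwf.2.2.2.2.2.1 f hf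
  rcases f with ⟨y, a, b', up⟩ | H
  · simp
  · simp only
    split_ifs
    · have : (H.card : ℝ) ≤ 3 := by exact_mod_cast hwf_f.2.2.1
      linarith
    · exact le_rfl

/-- **`rowTrans ≤ rowJoint`.** -/
theorem ResidueType.rowTrans_le_rowJoint (τ : ResidueType) (hwf : τ.WellFormed₂) (L₀ : EuclideanSpace ℝ (Fin 3) ≃ₗᵢ[ℝ] EuclideanSpace ℝ (Fin 3)) :
    τ.rowTrans L₀ ≤ τ.rowJoint L₀ :=
  localSummandFlatDec_le_of_systems (adm_trans_sub_joint L₀) (τ.fillerCredit_nonneg hwf) 0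

/-- **`rowTwin ≤ rowJoint`.** -/
theorem ResidueType.rowTwin_le_rowJoint (τ : ResidueType) (hwf : τ.WellFormed₂) (L₀ : EuclideanSpace ℝ (Fin 3) ≃ₗᵢ[ℝ] EuclideanSpace ℝ (Fin 3)) :
    τ.rowTwin L₀ ≤ τ.rowJoint L₀ :=
  localSummandFlatDec_le_of_systems (adm_twin_sub_joint L₀) (τ.fillerCredit_nonneg hwf) 0

end TailResidue

end Summit.Ventures.Crystal3D.Theorems



end
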